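import Summits.BirchSwinnertonDyer.BirchSwinnertonDyer.Theorems.SignedLowerHalvesKobayashiMainConjectureSmallImageTeichSpanLevelDescent
import HarnessLib

/-!
# Route `SignedLowerHalves`, crux `KobayashiMainConjectureSmallImage` (item stmt-BirchSwinnertonDyer-19002), line `birth_acns`,
# stub `stub_muOneSign_ns_ge5`: **CONJ B⁰ — no elliptic generators at `4 ∣ N`, cofinality at `4 ∣ N`** (sequel to
# `…TeichSpanLevelDescent.lean`; cell `bsd-ssimc`, seat `bsd-line-slh-p3` gen 9, LEAD; THEOREMS ONLY; helper `--supports stmt-BirchSwinnertonDyer-19002`)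

PROVENANCE: §4 of the ideator `bsd-idea-13` gen 11's crux workfile `Cruxes/KobayashiMainConjectureSmallImage/TeichSpanLevelDescent_g11.lean`
v2 (sha256 a63e69ff347e…), landed verbatim by the line's LEAD under `…Theorems.SmallImageTeichSpanLevelDescent` (planners do not land
`Theorems/`).  WHAT THIS FILE PROVES (group theory of `SL₂(ℤ)` / `Γ₀(N)` only):
* `sl2z_exists_pow_succ_eq` — integer Chebyshev recursion `g^(n+1) = u·g + w·1`, `|w| < |u|`, for `|tr g| ≥ 2`;
* `sl2z_eq_one_or_neg_one_of_isOfFinOrder` — finite order ∧ `|tr| ≥ 2` ⇒ `g = ±1`;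
* `eq_one_or_eq_negOne_of_isOfFinOrder_of_four_dvd` — at `4 ∣ N` a finite-order element of `Γ₀(N)` is `±1` (`ad ≡ 1 (mod 4)` with
  `a + d ∈ {0, ±1}` is insoluble, `decide` over `ZMod 4`; ε₂ = ε₃ = 0, Diamond–Shurman §3.7–3.8), `trEntry_of_isOfFinOrder_of_four_dvd`;
* `teichSpanGenerators_eq_of_four_dvd` — at `4 ∣ N` the B⁰ generator set is «packets ∪ trace ±2 ∪ p-th powers» (no elliptic part);
* `teichSpanGenAll_iff_forall_dvd_four` — `TeichSpanGenAll ↔` B⁰ on the cofinal family `4 ∣ N` (torsion-free `Γ₀(N)/±1`).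
USE: an attack on `stub_teichSpanGenAll` (cell `bsd-f3-mu`, crux 19630 LINE C) or on this line's rider via
`…SmallImageTeichOrbitMuLevel.exists_sign_hasUnitContent_of_teichSpanGen_of_dvd` may assume `4 ∣ N`.
HONEST FRAMING: B⁰ stays OPEN; crux 19002 stays OPEN; BSD is not proved by any of this; no summit statement is proved by this seat.
References: [Freitag1990] Ch. I Remark 1.5; [DiamondShurman2005] Prop. 2.3.3, §3.7–3.8; [Manin1972] Prop. 1.4.
-/

-- D-0017: single-problem summit, the namespace repeats the problem name by design.
set_option linter.dupNamespace false
set_option autoImplicit false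

noncomputable section

open scoped Classical MatrixGroups commutatorElement
open CongruenceSubgroup
open Literature.NumberTheory.EllipticCurves.Rank1Residual
open Summit.BirchSwinnertonDyer.BirchSwinnertonDyer.Cruxes.AnalyticMuZeroX9.TeichSpan

namespace Summit.BirchSwinnertonDyer.BirchSwinnertonDyer.Theorems.SmallImageTeichSpanLevelDescent

variable {N : ℕ}

/-! ### §4 At `4 ∣ N` there are no elliptic generators (so the cofinal family `4 ∣ N` has torsion-free `Γ₀(N)/±1`) -/

/-- Chebyshev recursion in `SL₂(ℤ)`: if `|tr g| ≥ 2` then `g^(n+1) = u·g + w·1` (entrywise) with `|w| < |u|`.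
[cite: Freitag1990, Ch. I §1 Remark 1.5] -/
theorem sl2z_exists_pow_succ_eq (g : SL(2, ℤ))
    (ht : 2 ≤ |(g : Matrix (Fin 2) (Fin 2) ℤ) 0 0 + (g : Matrix (Fin 2) (Fin 2) ℤ) 1 1|) (n : ℕ) :
    ∃ u w : ℤ,
      (((g ^ (n + 1) : SL(2, ℤ)) : Matrix (Fin 2) (Fin 2) ℤ) 0 0 = u * (g : Matrix (Fin 2) (Fin 2) ℤ) 0 0 + w ∧
       ((g ^ (n + 1) : SL(2, ℤ)) : Matrix (Fin 2) (Fin 2) ℤ) 0 1 = u * (g : Matrix (Fin 2) (Fin 2) ℤ) 0 1 ∧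
       ((g ^ (n + 1) : SL(2, ℤ)) : Matrix (Fin 2) (Fin 2) ℤ) 1 0 = u * (g : Matrix (Fin 2) (Fin 2) ℤ) 1 0 ∧
       ((g ^ (n + 1) : SL(2, ℤ)) : Matrix (Fin 2) (Fin 2) ℤ) 1 1 = u * (g : Matrix (Fin 2) (Fin 2) ℤ) 1 1 + w) ∧
      |w| < |u| := by
  set M : Matrix (Fin 2) (Fin 2) ℤ := (g : Matrix (Fin 2) (Fin 2) ℤ) with hM_def
  have hdet : M 0 0 * M 1 1 - M 0 1 * M 1 0 = 1 := by
    have := g.det_coe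
    rw [Matrix.det_fin_two] at this
    exact this
  induction n with
  | zero => exact ⟨1, 0, by simp [hM_def], by simp⟩
  | succ n ih =>
    obtain ⟨u, w, ⟨h00, h01, h10, h11⟩, hlt⟩ := ih
    refine ⟨u * (M 0 0 + M 1 1) + w, -u, ?_, ?_⟩
    · have hP : ((g ^ (n + 1 + 1) : SL(2, ℤ)) : Matrix (Fin 2) (Fin 2) ℤ)
          = ((g ^ (n + 1) : SL(2, ℤ)) : Matrix (Fin 2) (Fin 2) ℤ) * M := by
        rw [pow_succ, Matrix.SpecialLinearGroup.coe_mul]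
      refine ⟨?_, ?_, ?_, ?_⟩
      · rw [hP, Matrix.mul_apply, Fin.sum_univ_two, h00, h01]
        linear_combination (-u) * hdet
      · rw [hP, Matrix.mul_apply, Fin.sum_univ_two, h00, h01]
        ring
      · rw [hP, Matrix.mul_apply, Fin.sum_univ_two, h10, h11]
        ring
      · rw [hP, Matrix.mul_apply, Fin.sum_univ_two, h10, h11]
        linear_combination (-u) * hdet
    · rw [abs_neg]
      have h2 : 2 * |u| ≤ |u * (M 0 0 + M 1 1)| := by
        rw [abs_mul]; nlinarith [abs_nonneg u, ht]
      have h3 : |u * (M 0 0 + M 1 1)| ≤ |u * (M 0 0 + M 1 1) + w| + |w| := by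
        have := abs_sub (u * (M 0 0 + M 1 1) + w) w
        simpa using this
      linarith

/-- In `SL₂(ℤ)` an element of finite order with `|tr| ≥ 2` is `±1` (the Chebyshev coefficients force it to be scalar).
[cite: Freitag1990, Ch. I §1 Remark 1.5] [cite: DiamondShurman2005, Prop. 2.3.3] -/
theorem sl2z_eq_one_or_neg_one_of_isOfFinOrder (g : SL(2, ℤ)) (hfin : IsOfFinOrder g)
    (ht : 2 ≤ |(g : Matrix (Fin 2) (Fin 2) ℤ) 0 0 + (g : Matrix (Fin 2) (Fin 2) ℤ) 1 1|) :
    g = 1 ∨ g = -1 := by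
  obtain ⟨k, hk, hgk⟩ := isOfFinOrder_iff_pow_eq_one.mp hfin
  obtain ⟨n, rfl⟩ : ∃ n, k = n + 1 := Nat.exists_eq_succ_of_ne_zero hk.ne'
  obtain ⟨u, w, ⟨e00, e01, e10, e11⟩, hlt⟩ := sl2z_exists_pow_succ_eq g ht n
  rw [hgk] at e00 e01 e10 e11
  simp only [Matrix.SpecialLinearGroup.coe_one, Matrix.one_apply_eq, Matrix.one_apply_ne (by decide : (0 : Fin 2) ≠ 1),
    Matrix.one_apply_ne (by decide : (1 : Fin 2) ≠ 0)] at e00 e01 e10 e11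
  set M : Matrix (Fin 2) (Fin 2) ℤ := (g : Matrix (Fin 2) (Fin 2) ℤ) with hM_def
  have hu : u ≠ 0 := by
    rintro rfl
    have := abs_nonneg w
    simp at hlt
    linarith
  have hdet : M 0 0 * M 1 1 - M 0 1 * M 1 0 = 1 := by
    have := g.det_coe
    rw [Matrix.det_fin_two] at this
    exact this
  have h01 : M 0 1 = 0 := by
    rcases mul_eq_zero.mp e01.symm with h | h
    · exact absurd h hu
    · exact h
  have h10 : M 1 0 = 0 := by
    rcases mul_eq_zero.mp e10.symm with h | h
    · exact absurd h hu
    · exact h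
  have hdiag : M 0 0 = M 1 1 := mul_left_cancel₀ hu (by linarith)
  have hsq : M 0 0 * M 0 0 = 1 := by
    rw [h01, h10, ← hdiag] at hdet
    linarith
  rcases mul_self_eq_one_iff.mp hsq with h | h
  · left
    ext i j
    fin_cases i <;> fin_cases j <;> simp [← hM_def, h01, h10, h, ← hdiag]
  · right
    ext i j
    fin_cases i <;> fin_cases j <;> simp [← hM_def, h01, h10, h, ← hdiag]

/-- **No elliptic elements at `4 ∣ N`**: a finite-order element of `Γ₀(N)`, `4 ∣ N`, is `±1` (its trace `t = a + d`
would satisfy `a(t − a) ≡ 1 (mod 4)` with `t ∈ {0, ±1}`, insoluble).  [cite: DiamondShurman2005, §3.7–3.8 (ε₂ = ε₃ = 0 iff …)] -/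
theorem eq_one_or_eq_negOne_of_isOfFinOrder_of_four_dvd (h4 : 4 ∣ N) {γ : Gamma0 N} (hfin : IsOfFinOrder γ) :
    γ = 1 ∨ γ = negOneGamma0 N := by
  have hfin' : IsOfFinOrder (γ : SL(2, ℤ)) := (Gamma0 N).subtype.isOfFinOrder hfin
  set M : Matrix (Fin 2) (Fin 2) ℤ := ((γ : SL(2, ℤ)) : Matrix (Fin 2) (Fin 2) ℤ) with hM_def
  have hdet : M 0 0 * M 1 1 - M 0 1 * M 1 0 = 1 := by
    have := (γ : SL(2, ℤ)).det_coe
    rw [Matrix.det_fin_two] at this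
    exact this
  have hc : (4 : ℤ) ∣ M 1 0 :=
    (Int.natCast_dvd_natCast.mpr h4).trans ((ZMod.intCast_zmod_eq_zero_iff_dvd _ _).mp (Gamma0_mem.mp γ.2))
  have ht : 2 ≤ |M 0 0 + M 1 1| := by
    by_contra hlt
    rw [not_le] at hlt
    have key : ∀ a d : ZMod 4, a * d = 1 → ¬ (a + d = 0 ∨ a + d = 1 ∨ a + d = -1) := by decide
    have hc0 : ((M 1 0 : ℤ) : ZMod 4) = 0 := (ZMod.intCast_zmod_eq_zero_iff_dvd _ _).mpr hc
    have h1 : ((M 0 0 : ℤ) : ZMod 4) * ((M 1 1 : ℤ) : ZMod 4) = 1 := by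
      have := congrArg (Int.cast : ℤ → ZMod 4) hdet
      push_cast at this
      rw [hc0, mul_zero, sub_zero] at this
      exact this
    have htr : M 0 0 + M 1 1 = 0 ∨ M 0 0 + M 1 1 = 1 ∨ M 0 0 + M 1 1 = -1 := by
      have := abs_lt.mp hlt
      omega
    have h2 : ((M 0 0 : ℤ) : ZMod 4) + ((M 1 1 : ℤ) : ZMod 4) = 0 ∨
        ((M 0 0 : ℤ) : ZMod 4) + ((M 1 1 : ℤ) : ZMod 4) = 1 ∨
        ((M 0 0 : ℤ) : ZMod 4) + ((M 1 1 : ℤ) : ZMod 4) = -1 := by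
      rcases htr with h | h | h
      · left; exact_mod_cast congrArg (Int.cast : ℤ → ZMod 4) h
      · right; left; exact_mod_cast congrArg (Int.cast : ℤ → ZMod 4) h
      · right; right; exact_mod_cast congrArg (Int.cast : ℤ → ZMod 4) h
    exact key _ _ h1 h2
  rcases sl2z_eq_one_or_neg_one_of_isOfFinOrder _ hfin' ht with h | h
  · left
    exact Subtype.ext h
  · right
    exact Subtype.ext h

/-- At `4 ∣ N` a finite-order element of `Γ₀(N)` has trace `±2` — so the «finite order» clause of `teichSpanGenerators`
is redundant there. [cite: DiamondShurman2005, §3.7–3.8] -/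
theorem trEntry_of_isOfFinOrder_of_four_dvd (h4 : 4 ∣ N) {γ : Gamma0 N} (hfin : IsOfFinOrder γ) :
    trEntry γ = 2 ∨ trEntry γ = -2 := by
  rcases eq_one_or_eq_negOne_of_isOfFinOrder_of_four_dvd h4 hfin with rfl | rfl
  · left
    show ((1 : SL(2, ℤ)) : Matrix (Fin 2) (Fin 2) ℤ) 0 0 + ((1 : SL(2, ℤ)) : Matrix (Fin 2) (Fin 2) ℤ) 1 1 = 2
    simp
  · right
    exact trEntry_negOneGamma0 N

/-- **The generator set at `4 ∣ N`**: packets, trace-`±2` elements and `p`-th powers only (no elliptic generators).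
[cite: Manin1972, Prop. 1.4] [cite: DiamondShurman2005, §3.7–3.8] -/
theorem teichSpanGenerators_eq_of_four_dvd (h4 : 4 ∣ N) (p : ℕ) :
    teichSpanGenerators N p =
      teichPacketProducts N p ∪ {γ | trEntry γ = 2 ∨ trEntry γ = -2} ∪ {γ | ∃ h : Gamma0 N, γ = h ^ p} := by
  ext γ
  simp only [teichSpanGenerators, Set.mem_union, Set.mem_setOf_eq]
  constructor
  · rintro ((hP | hfin | htr) | hpow)
    · exact Or.inl (Or.inl hP)
    · exact Or.inl (Or.inr (trEntry_of_isOfFinOrder_of_four_dvd h4 hfin))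
    · exact Or.inl (Or.inr htr)
    · exact Or.inr hpow
  · rintro ((hP | htr) | hpow)
    · exact Or.inl (Or.inl hP)
    · exact Or.inl (Or.inr (Or.inr htr))
    · exact Or.inr hpow

/-- **COFINALITY at `4 ∣ N`** (torsion-free `Γ₀(N)/±1`, generator set of `teichSpanGenerators_eq_of_four_dvd`):
`TeichSpanGenAll ↔ ∀ N p, p prime, 5 ≤ p, p ∤ N, 4 ∣ N → TeichSpanGen N p`. [cite: Manin1972, Prop. 1.4] -/
theorem teichSpanGenAll_iff_forall_dvd_four :
    TeichSpanGenAll ↔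
      ∀ (N p : ℕ), p.Prime → 5 ≤ p → ¬ p ∣ N → 4 ∣ N → TeichSpanGen N p := by
  refine teichSpanGenAll_iff_forall_mul (fun _ => 4) ?_
  intro p _ h5 hd
  have := Nat.le_of_dvd (by norm_num) hd
  omega

end Summit.BirchSwinnertonDyer.BirchSwinnertonDyer.Theorems.SmallImageTeichSpanLevelDescent

end
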